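import Summits.BirchSwinnertonDyer.BirchSwinnertonDyer.Theorems.ThetaPartnerAtTwoSignedKatoUpToAtTwoFlatRoad
import Summits.BirchSwinnertonDyer.BirchSwinnertonDyer.Theorems.ThetaPartnerAtTwoSignedControlAtTwoStubPlusHondaSystemTwo
import HarnessLib

/-!
# Route `ThetaPartnerAtTwo` (TP2), crux K3 `SignedKatoDivisibilityUpToAtTwo` (item stmt-BirchSwinnertonDyer-20308),
# line `colemanrat` — file 22: **K3 BY NAME FROM THE ♭-KATO DIVISIBILITY OFF `2` ALONE** (HONDA⁺@2 discharged by the K4 seats'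
# theorem `Cruxes.SignedControlAtTwo.EulerChar.stub_plusHondaSystemTwo`), in the `∀` form of file 19 and in the weakest `∃` form

HONEST FRAMING (cell `bsd-wall`, width seat `bsd-wall-tp2-p2x-w2` g2): THEOREMS ONLY — no definition, no named fact, no instance,
no `sorry`; the K3-level theorems are CONDITIONAL on the displayed hypothesis (F) resp. (F∃) — the `a_2 = 0` case of Sprung's Thm.
7.16 at `p = 2`, NOT in print, exactly as hard as the crux; closes no item (`proof.conditional`); BSD is NOT proved by any of this.

## What is proved

* **`signedKatoDivisibilityUpToAtTwo_of_flatOffTwo`** — `SignedKatoDivisibilityUpToAtTwo` from (F) of file 19 ALONE: «for every habitat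
  datum, every `v ∋ 2`, every local lift `g`, every Honda system `d` ((L) (TR)) and every pinned
  `D♭ : SharpFlatSelmerDualData W κ γ (closureEmb ℚ_v) 0 g d .flat`: `ℓ_𝔭(D♭.X) ≤ ℓ_𝔭(Λ/(kobayashiL 1 L⁺ L⁻))` at every height-one
  `𝔭 ∌ 2`» (file 19's `…_of_flatOffTwo_of_honda` with (H) := the K4 theorem).
* **`signedKatoDivisibilityUpToAtTwo_of_exists_flatOffTwo`** — the same from the WEAKEST form (F∃): «for every habitat datum there EXIST
  `v ∋ 2`, a local lift `g`, a plus Honda system `d` ((L) (TR) (GEN) (GEN₀)) and ONE pinned `D♭` with the inequality at every height-one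
  `𝔭 ∌ 2`» (file 18's `ℓ_𝔭(X⁺) ≤ ℓ_𝔭(X♭)` for that datum). By file 21 (`sharpFlat_signed_agree_two`: `ℓ_𝔭(D♭.X) = ℓ_𝔭(D.X)` for the
  K4 system) (F), (F∃) and K3's certified off-two form are pairwise equivalent on the habitat; the pen may file either.

References: [Kobayashi2003] Thm. 1.3 (i), Def. 1.1, Thm. 8.18–Prop. 8.23; [Sprung2012] Def. 7.11, Thm. 7.14, Thm. 7.16 (pp. 1503–1505);
[KuriharaOtsuki2006] p. 557; [Kato2004Asterisque] Thm. 17.4.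
-/

set_option autoImplicit false
-- the Theorems namespace of this sub repeats the summit name by design (D-0017 nested layout)
set_option linter.dupNamespace false

noncomputable section

open scoped Classical MatrixGroups ModularForm NumberField

universe u

namespace Summit.BirchSwinnertonDyer.BirchSwinnertonDyer.Theorems

namespace SignedKatoOffTwo.FlatKernel

open CongruenceSubgroup NumberField IsDedekindDomain WeierstrassCurve Field
  Literature.NumberTheory.GaloisRepresentations
  Literature.NumberTheory.EllipticCurves Literature.NumberTheory.EllipticCurves.ModularForms
  Literature.NumberTheory.EllipticCurves.Module Literature.NumberTheory.EllipticCurves.Rank1Residual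
  Literature.NumberTheory.EllipticCurves.Kobayashi2003 Literature.NumberTheory.EllipticCurves.Sprung2012
  Literature.NumberTheory.EllipticCurves.Sprung2017 ZpExtension
  Summit.BirchSwinnertonDyer.Rank1Residual.Supersingular
  Summit.BirchSwinnertonDyer.BirchSwinnertonDyer.Theses.ThetaPartnerAtTwo

/-- **K3 `SignedKatoDivisibilityUpToAtTwo` BY NAME from the ♭-Kato divisibility off `2` (∀ form), HONDA⁺@2 DISCHARGED** by the K4 seats'
`Cruxes.SignedControlAtTwo.EulerChar.stub_plusHondaSystemTwo` (file `…SignedControlAtTwoStubPlusHondaSystemTwo`). Hypothesis (F): for every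
habitat datum, every `v ∋ 2`, every local lift `g`, every Honda system `d` ((L) (TR)) and every pinned ♭ dual datum:
`ℓ_𝔭(D♭.X) ≤ ℓ_𝔭(Λ/(kobayashiL 1 L⁺ L⁻))` at every height-one `𝔭 ∌ 2` (NOT in print at `p = 2`).
[cite: Kobayashi2003, Thm. 1.3 (i) (p. 2)] [cite: Sprung2012, Thm. 7.16 (p. 1504)] [cite: KuriharaOtsuki2006, p. 557] -/
theorem signedKatoDivisibilityUpToAtTwo_of_flatOffTwo
    (hF : ∀ (W : WeierstrassCurve ℚ) [W.IsElliptic] [W.IsGloballyMinimal],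
      ¬ W.HasCM → W.analyticRank = 0 → GoodSS W 2 → W.frobeniusTrace 2 = 0 →
      ∀ (κ : ZpExtension ℚ 2) (γ : Field.absoluteGaloisGroup ℚ),
        κ.IsCyclotomic → κ.IsTopGenerator γ → IsCyclotomicVariable 2 γ →
        ∀ [NeZero (W.conductorNorm ℤ)] (f : CuspForm (Gamma0 (W.conductorNorm ℤ)) 2),
          IsNewformOf W f → ∀ (ϖ : ℚ), (ϖ : ℝ) * W.realPeriodRat = plusPeriod f →
        ∀ (Lplus Lminus : IwasawaAlgebra 2), IsPollackPair f 2 Lplus Lminus →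
        ∀ (v : HeightOneSpectrum (𝓞 ℚ)), (2 : 𝓞 ℚ) ∈ v.asIdeal →
        ∀ (g : Field.absoluteGaloisGroup (v.adicCompletion ℚ)),
          κ.IsTopGenerator (resGalOfEmb (closureEmb (K := ℚ) (v.adicCompletion ℚ)) g) →
        ∀ (d : ℕ → localPoints W (v.adicCompletion ℚ)),
          (∀ m, d m ∈ localLayerPointsOfEmb κ (closureEmb (K := ℚ) (v.adicCompletion ℚ)) W m) →
          (∀ m, localTraceOfEmb κ (closureEmb (K := ℚ) (v.adicCompletion ℚ)) W (m + 1) (m + 2) (d (m + 2)) = -d m) →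
        ∀ (Df : SharpFlatSelmerDualData W κ γ (closureEmb (K := ℚ) (v.adicCompletion ℚ)) 0 g d .flat)
          (𝔭 : PrimeSpectrum (IwasawaAlgebra 2)), 𝔭.asIdeal.height = 1 → PowerSeries.C (2 : ℤ_[2]) ∉ 𝔭.asIdeal →
          lengthAt (IwasawaAlgebra 2) Df.X 𝔭 ≤
            lengthAt (IwasawaAlgebra 2) (IwasawaAlgebra 2 ⧸ Ideal.span {kobayashiL 1 Lplus Lminus}) 𝔭) :
    SignedKatoDivisibilityUpToAtTwo :=
  signedKatoDivisibilityUpToAtTwo_of_flatOffTwo_of_honda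
    Summit.BirchSwinnertonDyer.BirchSwinnertonDyer.Cruxes.SignedControlAtTwo.EulerChar.stub_plusHondaSystemTwo hF

/-- **K3 `SignedKatoDivisibilityUpToAtTwo` BY NAME from the WEAKEST ♭ form (F∃)**: for every habitat datum there EXIST a place `v ∋ 2`, a
local lift `g` of `γ`'s image, a plus Honda system `d` ((L) (TR) (GEN) (GEN₀)) and ONE pinned ♭ dual datum `D♭` with
`ℓ_𝔭(D♭.X) ≤ ℓ_𝔭(Λ/(kobayashiL 1 L⁺ L⁻))` at every height-one `𝔭 ∌ 2`. Proof: K3's local form off `2` for the given `D` by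
`ℓ_𝔭(D.X) ≤ ℓ_𝔭(D♭.X)` (file 18) and (F∃). [cite: Kobayashi2003, Thm. 1.3 (i), Thm. 8.18–Prop. 8.23] [cite: Sprung2012, Thm. 7.16 (p. 1504)] -/
theorem signedKatoDivisibilityUpToAtTwo_of_exists_flatOffTwo
    (hF : ∀ (W : WeierstrassCurve ℚ) [W.IsElliptic] [W.IsGloballyMinimal],
      ¬ W.HasCM → W.analyticRank = 0 → GoodSS W 2 → W.frobeniusTrace 2 = 0 →
      ∀ (κ : ZpExtension ℚ 2) (γ : Field.absoluteGaloisGroup ℚ),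
        κ.IsCyclotomic → κ.IsTopGenerator γ → IsCyclotomicVariable 2 γ →
        ∀ [NeZero (W.conductorNorm ℤ)] (f : CuspForm (Gamma0 (W.conductorNorm ℤ)) 2),
          IsNewformOf W f → ∀ (ϖ : ℚ), (ϖ : ℝ) * W.realPeriodRat = plusPeriod f →
        ∀ (Lplus Lminus : IwasawaAlgebra 2), IsPollackPair f 2 Lplus Lminus →
        ∃ (v : HeightOneSpectrum (𝓞 ℚ)) (_ : (2 : 𝓞 ℚ) ∈ v.asIdeal)
          (g : Field.absoluteGaloisGroup (v.adicCompletion ℚ)) (d : ℕ → localPoints W (v.adicCompletion ℚ))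
          (Df : SharpFlatSelmerDualData W κ γ (closureEmb (K := ℚ) (v.adicCompletion ℚ)) 0 g d .flat),
          κ.IsTopGenerator (resGalOfEmb (closureEmb (K := ℚ) (v.adicCompletion ℚ)) g) ∧
          (∀ m, d m ∈ localLayerPointsOfEmb κ (closureEmb (K := ℚ) (v.adicCompletion ℚ)) W m) ∧
          (∀ m, localTraceOfEmb κ (closureEmb (K := ℚ) (v.adicCompletion ℚ)) W (m + 1) (m + 2) (d (m + 2)) = -d m) ∧
          (∀ m : ℕ, 1 ≤ m → ∀ P ∈ localLayerPointsOfEmb κ (closureEmb (K := ℚ) (v.adicCompletion ℚ)) W m,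
            ∃ B ∈ AddSubgroup.closure (Set.range fun σ : Field.absoluteGaloisGroup (v.adicCompletion ℚ) ↦ σ • d m),
              ∃ P' ∈ localLayerPointsOfEmb κ (closureEmb (K := ℚ) (v.adicCompletion ℚ)) W (m - 1),
              ∃ R ∈ localLayerPointsOfEmb κ (closureEmb (K := ℚ) (v.adicCompletion ℚ)) W m, P = B + P' + 2 • R) ∧
          (∀ P ∈ localLayerPointsOfEmb κ (closureEmb (K := ℚ) (v.adicCompletion ℚ)) W 0,
            ∃ a : ℤ, ∃ R ∈ localLayerPointsOfEmb κ (closureEmb (K := ℚ) (v.adicCompletion ℚ)) W 0, P = a • d 0 + 2 • R) ∧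
          ∀ 𝔭 : PrimeSpectrum (IwasawaAlgebra 2), 𝔭.asIdeal.height = 1 → PowerSeries.C (2 : ℤ_[2]) ∉ 𝔭.asIdeal →
            lengthAt (IwasawaAlgebra 2) Df.X 𝔭 ≤
              lengthAt (IwasawaAlgebra 2) (IwasawaAlgebra 2 ⧸ Ideal.span {kobayashiL 1 Lplus Lminus}) 𝔭) :
    SignedKatoDivisibilityUpToAtTwo := by
  refine signedKatoDivisibilityUpToAtTwo_of_offTwo ?_
  intro W _ _ hcm hr hss ha κ γ hκ hγ hcv _ f hf ϖ hϖ Lplus Lminus hPP D _ 𝔭 h𝔭 h2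
  obtain ⟨v, hv, g, d, Df, hg, hd, htr, hgen, hgen0, hle⟩ := hF W hcm hr hss ha κ γ hκ hγ hcv f hf ϖ hϖ Lplus Lminus hPP
  exact (lengthAt_signed_le_lengthAt_sharpFlat_two W hss hκ v hv hg hd htr hgen hgen0 D Df 𝔭).trans (hle 𝔭 h𝔭 h2)

end SignedKatoOffTwo.FlatKernel

end Summit.BirchSwinnertonDyer.BirchSwinnertonDyer.Theorems

end
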